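import Literature.AlgebraicGeometry.Frobenioids.Prop55SubRatStdSlot
import Literature.AlgebraicGeometry.Frobenioids.GeometricFrobenioidStandard
import Literature.AlgebraicGeometry.Frobenioids.GeometricFrobenioidRational
import Literature.AlgebraicGeometry.Frobenioids.ModelFrobenioidBiratNormalized
import HarnessLib

/-!
# Frobenioids I, Theorem 6.2 (iii) "of rationally standard type" AT THE parameters of Def. 4.5 (iii):
# everything but the Frobenius-compact object of `(C^un-tr)^birat` — PROOF

Mochizuki, *The geometry of Frobenioids I: the general theory*, Kyushu J. Math. **62** (2008) 293–400, Thm. 6.2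
(iii), kurims text p. 111 ("If, moreover, for every finite extension `L ⊆ K̃` of `K`, and every `D ∈ D_L`, it
holds that `D` lies in the support of the image in `Φ(L)^gp` of an element of `B(L)`, then `C` is of rationally
standard type"), proof p. 112; Def. 4.5 (iii) p. 86. [cite: MochizukiFrdI2008, Thm. 6.2 (iii) p.111]

PROOF-ONLY (seat abc-iut-L6-t10 gen 2, S3 sub-DAG holder, node T62iii at THE data). The typed node
`Thm62iii M Bi R` (abc-iut-L1-t3, `GeometricFrobenioids.lean`) is a SCHEMA over a birationalization `Bi` and the
Def. 4.5 (iii) parameters `R`. Here both are THE constructions for the geometric Frobenioid `C_{K̃/K}` of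
`Γ : GeometricDivisorData K Kt` (v4): `Bi = C^birat` (Prop. 4.4), `R = PreFrobenioid.rsParams hF (PrimarySupp)`
(`Supp` = Def. 2.4 (i)(d) read on primary elements (`PrimarySupp`, abc-iut `Prop55SubRatStdSlot.lean`), `SU`/`BU` = `C^un-tr` and its birationalization):
* `geom_isRational_rsParams` — under the printed hypothesis (every prime is a zero or pole of a rational function)
  every object is rational w.r.t. THE `(C^birat, Supp)` (`isRational_geom`, v4 `sub_mem`, support axiom by `Iff.rfl`);
* `geom_isOfBiratFrobeniusNormalizedType_rsParams` — THE `C^birat` is birationally Frobenius-normalized;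
* `Thm62iii_rsParams_iff` — **`Thm62iii (geomModelFrobenioid Γ) (THE Bi) (THE R)` ⟺ (printed hypothesis ⟹
  `(C^un-tr)^birat` admits a Frobenius-compact object)**; `Thm62iii_rsParams_of_frobCompact` the usable direction.
No definitions; nothing here bears on [IUTchIII] or asserts anything about abc.
-/

noncomputable section

namespace Literature.AlgebraicGeometry.Frobenioids

open CategoryTheory Opposite

variable {K : Type} [Field K] {Kt : Type} [Field Kt] [Algebra K Kt] [IsGalois K Kt] (Γ : GeometricDivisorData K Kt)

/-- **Every object of `C_{K̃/K}` is rational w.r.t. THE `(C^birat, Supp)`**, granted that every prime divisor is a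
zero or a pole of a rational function (Thm. 6.2 (iii) hypothesis). [cite: MochizukiFrdI2008, Thm. 6.2 (iii) p.112] -/
theorem geom_isRational_rsParams
    (hsupport : ∀ (X : FinSubextCat K Kt) (P : Γ.primeDiv X), ∃ f : Γ.B X, (Multiplicative.toAdd (Γ.div X f)) P ≠ 0)
    (A : geomFrobenioid Γ) :
    PreFrobenioidData.IsRational
      (PreFrobenioid.rsParams (geomFrobenioid_isFrobenioid Γ) fun a 𝔭 => PrimarySupp a 𝔭).B
      (PreFrobenioid.rsParams (geomFrobenioid_isFrobenioid Γ) fun a 𝔭 => PrimarySupp a 𝔭).Supp A :=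
  isRational_geom Γ Γ.sub_mem hsupport (geomFrobenioid_isFrobenioid Γ)
    (PreFrobenioid.hasBiratSquares_of_isFrobenioid (geomFrobenioid_isFrobenioid Γ)) _
    (fun _ _ _ => Iff.rfl) A

/-- **THE birationalization `C_{K̃/K}^birat` is of birationally Frobenius-normalized type** (Thm. 5.2 (ii) via
abc-iut-L1-d10: `Φ` divisorial, `B` group-like). [cite: MochizukiFrdI2008, Thm. 5.2 (ii) p.100] -/
theorem geom_isOfBiratFrobeniusNormalizedType_rsParams :
    PreFrobenioidData.IsOfBiratFrobeniusNormalizedType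
      (PreFrobenioid.rsParams (geomFrobenioid_isFrobenioid Γ) fun a 𝔭 => PrimarySupp a 𝔭).B :=
  ModelFrobenioid.isOfBiratFrobeniusNormalizedType_of_isDivisorial (geomFrobenioid_isFrobenioid Γ)
    (PreFrobenioid.hasBiratSquares_of_isFrobenioid (geomFrobenioid_isFrobenioid Γ))
    (fun X => Γ.isDivisorial_phi X) (geomUnitsFunctor_isGroupLike Γ)

/-- **`C_{K̃/K}` is of rationally standard type w.r.t. THE parameters iff `(C^un-tr)^birat` admits a
Frobenius-compact object**, under the printed zero-or-pole hypothesis. [cite: MochizukiFrdI2008, Thm. 6.2 (iii) p.112] -/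
theorem geom_isOfRationallyStandardType_rsParams_iff
    (hsupport : ∀ (X : FinSubextCat K Kt) (P : Γ.primeDiv X), ∃ f : Γ.B X, (Multiplicative.toAdd (Γ.div X f)) P ≠ 0) :
    (geomFrobenioidOps Γ).IsOfRationallyStandardType
        (PreFrobenioid.rsParams (geomFrobenioid_isFrobenioid Γ) fun a 𝔭 => PrimarySupp a 𝔭) ↔
      ∃ X : (PreFrobenioid.rsParams (geomFrobenioid_isFrobenioid Γ) fun a 𝔭 => PrimarySupp a 𝔭).BU.Birat,
        (PreFrobenioid.rsParams (geomFrobenioid_isFrobenioid Γ) fun a 𝔭 => PrimarySupp a 𝔭).BU.ops.IsFrobeniusCompact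
          X :=
  ⟨fun h => h.frobCompact, fun h =>
    ⟨geom_isOfBiratFrobeniusNormalizedType_rsParams Γ, geom_isRational_rsParams Γ hsupport,
      isOfStandardType_geom Γ, h⟩⟩

/-- **Theorem 6.2 (iii) at THE birationalization and THE parameters of Def. 4.5 (iii)**: the typed node holds IF
AND ONLY IF the printed hypothesis (every prime divisor is a zero or pole of a rational function) yields a
Frobenius-compact object of `(C^un-tr)^birat` — non-dilating, standard, birationally Frobenius-normalized and
rational being PROVED. [cite: MochizukiFrdI2008, Thm. 6.2 (iii) p.112] -/
theorem Thm62iii_rsParams_iff :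
    Thm62iii (geomModelFrobenioid Γ)
        (PreFrobenioid.biratData (geomFrobenioid_isFrobenioid Γ)
          (PreFrobenioid.hasBiratSquares_of_isFrobenioid (geomFrobenioid_isFrobenioid Γ)))
        (PreFrobenioid.rsParams (geomFrobenioid_isFrobenioid Γ) fun a 𝔭 => PrimarySupp a 𝔭) ↔
      ((∀ (X : FinSubextCat K Kt) (P : Γ.primeDiv X), ∃ f : Γ.B X, (Multiplicative.toAdd (Γ.div X f)) P ≠ 0) →
        ∃ X : (PreFrobenioid.rsParams (geomFrobenioid_isFrobenioid Γ) fun a 𝔭 => PrimarySupp a 𝔭).BU.Birat,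
          (PreFrobenioid.rsParams (geomFrobenioid_isFrobenioid Γ) fun a 𝔭 => PrimarySupp a 𝔭).BU.ops.IsFrobeniusCompact
            X) := by
  rw [Thm62iii_iff_inputs]
  constructor
  · rintro ⟨-, h⟩ hsupport
    exact ((geom_isOfRationallyStandardType_rsParams_iff Γ hsupport).mp (h hsupport))
  · intro h
    exact ⟨geom_isOfBiratFrobeniusNormalizedType_rsParams Γ, fun hsupport =>
      (geom_isOfRationallyStandardType_rsParams_iff Γ hsupport).mpr (h hsupport)⟩

/-- **Theorem 6.2 (iii) at THE data, from a Frobenius-compact object of `(C^un-tr)^birat`.**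
[cite: MochizukiFrdI2008, Thm. 6.2 (iii) p.112] -/
theorem Thm62iii_rsParams_of_frobCompact
    (h : ∃ X : (PreFrobenioid.rsParams (geomFrobenioid_isFrobenioid Γ) fun a 𝔭 => PrimarySupp a 𝔭).BU.Birat,
      (PreFrobenioid.rsParams (geomFrobenioid_isFrobenioid Γ) fun a 𝔭 => PrimarySupp a 𝔭).BU.ops.IsFrobeniusCompact X) :
    Thm62iii (geomModelFrobenioid Γ)
        (PreFrobenioid.biratData (geomFrobenioid_isFrobenioid Γ)
          (PreFrobenioid.hasBiratSquares_of_isFrobenioid (geomFrobenioid_isFrobenioid Γ)))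
        (PreFrobenioid.rsParams (geomFrobenioid_isFrobenioid Γ) fun a 𝔭 => PrimarySupp a 𝔭) :=
  (Thm62iii_rsParams_iff Γ).mpr fun _ => h

end Literature.AlgebraicGeometry.Frobenioids

end
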